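import Summits.BirchSwinnertonDyer.BirchSwinnertonDyer.Theorems.UniversalToricDescentTameQuotientVanishing
import Summits.BirchSwinnertonDyer.BirchSwinnertonDyer.Theorems.UniversalToricDescentInertiaPrimeToP
import Summits.BirchSwinnertonDyer.BirchSwinnertonDyer.Theorems.UniversalToricDescentMultiplicativeLocalTerm
import Literature.NumberTheory.GaloisRepresentations.ContinuousH1TrivialAction
import Literature.NumberTheory.EllipticCurves.InertiaInvariantsPrimaryTorsionAdditiveProofs
import HarnessLib

/-!
# Route UniversalToricDescent — Greenberg–Vatsal Prop. (2.4) at an ADDITIVE place `v ∤ p`: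
# `H¹(I_v, E[p^∞]) = 0`, hence `#H¹(kerD κ v, E[p^∞])[p] = 1` (`s_v = 0`)

Lead prover bsd-wall-utd-p1 g10 (`--supports stmt-BirchSwinnertonDyer-20399`; the VALUE of the local term
`s_v` of 21845's algebraic half `invariantsTransportT_algebraicHalf_lambda` at the places of Σ where the
curve has ADDITIVE reduction — completing the closed forms of g9: good `v`: `s_v = d_v ∈ {0,1,2}`
(`UniversalToricDescentGoodLocalTermTrichotomy`), multiplicative `v`: `s_v = [p ∣ ε − q_v]`
(`UniversalToricDescentMultiplicativeLocalTerm`), additive `v`: **`s_v = 0`** (this file)).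

* `subsingleton_continuousCohomology_one_absInertia_of_finite_invariants` — for a non-archimedean local
  field `F` of characteristic `0` with residue characteristic `≠ p` and a discrete `p`-primary,
  `p`-divisible `Γ_F`-module `A` with finite layers `A[p^k]` and FINITE inertia invariants `A^{I_F}`:
  **`H¹(I_F, A) = 0`**. (The tree had `#H¹(I_F, A)[p^k] ≤ #(A[p^k])^{I_F}`, `InertiaCohomologyTorsionBound`,
  and the finiteness of `H¹(I_v, E[p^∞])` at an additive place, X2's `LocalInertiaCohomologyAdditive`; the
  exact vanishing is Greenberg–Vatsal's `H¹(I_ℓ, A) = (A^{J_ℓ})_{τ}(−1)` with `τ − 1` invertible on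
  `V^{J_ℓ}` because `V^{I_ℓ} = 0`.) Assembly of `UniversalToricDescentInertiaPrimeToP` (the prime-to-`p`
  kernel `J ⊴ I_F`, `I_F = cl⟨J, τ⟩`) and `UniversalToricDescentTameQuotientVanishing`.
* `natCard_pTorsion_subgroupH1_kerD_eq_one_of_hasAdditiveReductionAt` — for `E/K` with ADDITIVE
  reduction at `v ∤ p`, `v` finitely decomposed in the `ℤ_p`-extension `κ` (`D_v ⊄ ker κ`):
  **`#{f ∈ H¹(kerD κ v, E[p^∞]) : p • f = 0} = 1`**, i.e. `s_v = 0` — the Euler factor at an additive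
  place is `1`, and so is its `λ`-contribution. Inputs: `E[p^∞]^{I_v}` finite at an additive `v ∤ p`
  (`finite_setOf_primaryTorsionGaloisRep_localMap_fixed_of_hasAdditiveReductionAt`, Serre–Tate), the
  transports `kerD κ v ≅ ker κ ⊓ D_v ↔ Gal(K̄_v/K_{∞,w}) = Hi` and `res : H¹(Hi, A) ⥲ H¹(I_v, A)^{Hi}`
  (g9), and inflation along `I_v ≅ I_v ∩ Hi`.

THEOREMS ONLY; no definition, no named fact, no `sorry`. BSD is not advanced by this file.
References: [GreenbergVatsal2000] §2 Prop. (2.4) and proof (arXiv p. 22); [GreenbergLNM1716] §3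
Lemma 3.3; [SilvermanATAEC1994] Thm. IV.10.2(a); [SerreTate1968] §1 Lemma 2.
-/

set_option autoImplicit false
-- `…BirchSwinnertonDyer.BirchSwinnertonDyer.Theorems…` is the problem's mandated namespace (D-0017).
set_option linter.dupNamespace false

noncomputable section

open scoped Classical

namespace Summit.BirchSwinnertonDyer.BirchSwinnertonDyer.Theorems.UniversalToricDescentAdditiveLocalTerm

open Function NumberField IsDedekindDomain Field WeierstrassCurve ValuativeRel CategoryTheory
open Literature.NumberTheory.EllipticCurves Literature.NumberTheory.EllipticCurves.GreenbergSelmer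
  Literature.NumberTheory.GaloisRepresentations IsDedekindDomain.HeightOneSpectrum ContinuousCohomology
  Literature.NumberTheory.EllipticCurves.BigGaloisRep
  Literature.NumberTheory.GaloisRepresentations.IsNonarchimedeanLocalField
  Summit.BirchSwinnertonDyer.Rank1Residual.X11b Summit.BirchSwinnertonDyer.Rank1Residual.X11b.Coinv
  Summit.BirchSwinnertonDyer.Rank1Residual.Iwasawa
  Summit.BirchSwinnertonDyer.BirchSwinnertonDyer.Theorems.UniversalToricDescentGoodLocalTermTrichotomy
  Summit.BirchSwinnertonDyer.BirchSwinnertonDyer.Theorems.UniversalToricDescentLocalH1Count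
  Summit.BirchSwinnertonDyer.BirchSwinnertonDyer.Theorems.UniversalToricDescentLocalH1Transfer
  Summit.BirchSwinnertonDyer.BirchSwinnertonDyer.Theorems.UniversalToricDescentMultiplicativeLocalTerm
  Summit.BirchSwinnertonDyer.BirchSwinnertonDyer.Theorems.UniversalToricDescentTameQuotientVanishing
  Summit.BirchSwinnertonDyer.BirchSwinnertonDyer.Theorems.UniversalToricDescentInertiaPrimeToP
  Summit.BirchSwinnertonDyer.BirchSwinnertonDyer.Theorems.SigmaLocal

/-! ### §0 Topological generation: integer exponents to natural exponents -/

section Generation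

variable {G : Type} [Group G] [TopologicalSpace G] [IsTopologicalGroup G] [CompactSpace G]

/-- If `G = ⋃_{k ∈ ℤ} τᵏ N U` at every open normal level `U`, then also `G = ⋃_{k ∈ ℕ} τᵏ N U`
(`τ` has finite order modulo the open, finite-index `U`). [folklore] -/
theorem forall_exists_pow_of_forall_exists_zpow (N : Subgroup G) (τ : G)
    (hgen : ∀ U : Subgroup G, U.Normal → IsOpen (U : Set G) →
      ∀ σ : G, ∃ k : ℤ, ∃ n ∈ N, ∃ u ∈ U, σ = τ ^ k * n * u) :
    ∀ U : Subgroup G, U.Normal → IsOpen (U : Set G) →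
      ∀ σ : G, ∃ k : ℕ, ∃ n ∈ N, ∃ u ∈ U, σ = τ ^ k * n * u := by
  intro U hU hUo σ
  obtain ⟨k, n, hn, u, hu, rfl⟩ := hgen U hU hUo σ
  haveI : Finite (G ⧸ U) := Subgroup.quotient_finite_of_isOpen U hUo
  set m : ℕ := U.index with hm
  have hm0 : (m : ℤ) ≠ 0 := by exact_mod_cast Subgroup.index_ne_zero_iff_finite.mpr inferInstance
  have hτm : τ ^ m ∈ U := Subgroup.pow_index_mem U τ
  -- `k = m q + r`, `0 ≤ r`
  set r : ℤ := k % m with hr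
  set q : ℤ := k / m with hq
  have hk : k = r + m * q := (Int.emod_add_mul_ediv k m).symm
  have hr0 : 0 ≤ r := Int.emod_nonneg k hm0
  have hx : (τ ^ (m : ℤ)) ^ q ∈ U := Subgroup.zpow_mem U (by rwa [zpow_natCast]) q
  refine ⟨r.toNat, n, hn, (n⁻¹ * (τ ^ (m : ℤ)) ^ q * n) * u, U.mul_mem ?_ hu, ?_⟩
  · have := hU.conj_mem _ hx n⁻¹
    rwa [inv_inv] at this
  · rw [← zpow_natCast, Int.toNat_of_nonneg hr0]
    conv_lhs => rw [hk, zpow_add, zpow_mul]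
    group

end Generation

/-! ### §1 `H¹(I_F, A) = 0` when `A^{I_F}` is finite -/

section Local

variable (F : Type) [Field F] [ValuativeRel F] [TopologicalSpace F] [IsNonarchimedeanLocalField F]
  [CharZero F]
variable {A : Type} [AddCommGroup A] [TopologicalSpace A] [DiscreteTopology A]

/-- **`H¹(I_F, A) = 0` for a discrete `p`-divisible `p`-primary `Γ_F`-module with finite layers and FINITE
`I_F`-invariants** (`F` non-archimedean local of characteristic `0`, residue characteristic `≠ p`):
`H¹(I_F, A) = H¹(I_F/J, A^J) = (A^J)/(τ − 1)(A^J) = 0`, `J` the prime-to-`p` kernel, `τ` a tame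
`p`-generator, `τ − 1` onto on the divisible `A^J` since its kernel `A^{I_F}` is finite — Greenberg–Vatsal's
computation in the case `V^{I_F} = 0`. [cite: GreenbergVatsal2000, §2, proof of Prop. (2.4) (arXiv p. 22)]
[cite: SerreLocalFields1979, Ch. XIII §1 Prop. 1] -/
theorem subsingleton_continuousCohomology_one_absInertia_of_finite_invariants {p : ℕ} [Fact p.Prime]
    (hℓ : ringChar 𝓀[F] ≠ p) (ρ : ContinuousRep (absoluteGaloisGroup F) ℤ A)
    (hA : ∀ a : A, ∃ k : ℕ, p ^ k • a = 0) (hdiv : ∀ a : A, ∃ b : A, p • b = a)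
    (hfin : ∀ k : ℕ, Set.Finite {a : A | p ^ k • a = 0})
    (hfix : Set.Finite {a : A | ∀ σ ∈ absInertia F, ρ σ a = a}) :
    Subsingleton (continuousCohomology 1 ((ρ.restrict (Literature.NumberTheory.GaloisRepresentations.subgroupIncl (absInertia F))).toTopRep)) := by
  haveI : CompactSpace (absoluteGaloisGroup F) := absoluteGaloisGroup_compactSpace F
  haveI : TotallyDisconnectedSpace (absoluteGaloisGroup F) := by
    change TotallyDisconnectedSpace (AlgebraicClosure F ≃ₐ[F] AlgebraicClosure F); infer_instance
  have hIcl : IsClosed (absInertia F : Set (absoluteGaloisGroup F)) := isClosed_absInertia_holds F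
  haveI : CompactSpace (absInertia F) := isCompact_iff_compactSpace.mp hIcl.isCompact
  obtain ⟨τ, hgen, -, -⟩ := exists_tame_generator_continuousCohomology_absInertia F (p := p) hℓ
  obtain ⟨J, hJn, hJc, hJcop, hJgen⟩ := exists_proPrimeToP_normal_absInertia F hℓ τ hgen
  haveI := hJn
  refine subsingleton_continuousCohomology_one_of_proPrimeToP_of_topGenerator
    (ρ.restrict (Literature.NumberTheory.GaloisRepresentations.subgroupIncl (absInertia F))) hA hdiv hfin J
    hJc hJcop τ (forall_exists_pow_of_forall_exists_zpow J τ hJgen) ?_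
  exact hfix.subset fun a ha σ hσ ↦ ha ⟨σ, hσ⟩

end Local

/-! ### §2 The local term at an additive place -/

variable {K : Type} [Field K] [NumberField K] (W : WeierstrassCurve K) [W.IsElliptic] {p : ℕ}
  [Fact p.Prime] (κ : ZpExtension K p) {v : HeightOneSpectrum (𝓞 K)}

/-- **Greenberg–Vatsal Prop. (2.4) at a place of ADDITIVE reduction: `s_v = 0`.** For `E/K` with additive
reduction at `v ∤ p` and `v` finitely decomposed in the `ℤ_p`-extension `κ` (`D_v ⊄ ker κ`):
**`#{f ∈ H¹(kerD κ v, E[p^∞]) : p • f = 0} = 1`**. Chain: `kerD κ v ≅ ker κ ⊓ D_v ↔ Gal(K̄_v/K_{∞,w}) = Hi`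
on `H¹(·, E[p^∞])[p]`; `res : H¹(Hi, A) ⥲ H¹(I_v, A)^{Hi}` (`Hi/I_v` pro-prime-to-`p`); and
`H¹(I_v, E[p^∞]) = 0` (§1, with `E[p^∞]^{I_v}` finite at an additive `v ∤ p`, Serre–Tate / *ATAEC*
IV.10.2(a)). [cite: GreenbergVatsal2000, §2 Prop. (2.4) and proof (arXiv p. 22)]
[cite: GreenbergLNM1716, §3 Lemma 3.3] [cite: SilvermanATAEC1994, Thm. IV.10.2(a)] -/
theorem natCard_pTorsion_subgroupH1_kerD_eq_one_of_hasAdditiveReductionAt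
    (hpv : (p : 𝓞 K) ∉ v.asIdeal) (hD : ¬ (decomp v ≤ κ.kerSubgroup))
    (hv : W.HasAdditiveReductionAt v) :
    Nat.card {f : Literature.NumberTheory.EllipticCurves.subgroupH1 (kerD κ v)
        (W.geomPrimaryTorsion p) // p • f = 0} = 1 := by
  letI inst : DistribMulAction (absoluteGaloisGroup (v.adicCompletion K)) (geomPoints W) :=
    DistribMulAction.compHom _ (absGaloisRestrict K (v.adicCompletion K)).toMonoidHom
  -- notation
  let Fv := v.adicCompletion K
  let G : Type := absoluteGaloisGroup Fv
  let Hi : Subgroup G := localSubgroup κ.kerSubgroup Fv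
  let I : Subgroup G := absInertia Fv
  let A' : Type := PrimaryTorsion (geomPoints W) p
  haveI : CharZero Fv := charZero_of_injective_algebraMap (algebraMap K Fv).injective
  haveI := absoluteGaloisGroup_compactSpace Fv
  have hℓ : ringChar 𝓀[Fv] ≠ p := v.ringChar_residueField_adicCompletion_ne hpv
  -- `v` not split completely: some `σ ∈ Γ_{K_v}` restricts outside `ker κ`
  have hns : ∃ σ : G, σ ∉ Hi := by
    by_contra hall
    refine hD fun g hg ↦ ?_
    obtain ⟨σ, rfl⟩ := (mem_decomp_iff v g).mp hg
    have hσ : σ ∈ Hi := not_not.mp fun h ↦ hall ⟨σ, h⟩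
    have h := (mem_localSubgroup_iff κ.kerSubgroup Fv σ).mp hσ
    rwa [resGal_eq_absGaloisRestrict] at h
  -- the local representation on `E[p^∞]`, in two currencies
  let ρ' : ContinuousRep G ℤ_[p] A' := (W.primaryTorsionGaloisRep p).restrict (localMap K (Sum.inl v))
  have hcont : ∀ a : A', Continuous fun g : G ↦ g • a := fun a ↦ ρ'.continuous_apply_left a
  let ρ : ContinuousRep G ℤ A' :=
    { toRepresentation := (discreteContRep G A').toRepresentation
      continuous_smul := continuous_prod_of_discrete_right.mpr fun a ↦ hcont a }
  have hA : ∀ a : A', ∃ k : ℕ, p ^ k • a = 0 := primaryTorsion_exists_pow_nsmul_eq_zero W p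
  have hfin : ∀ k : ℕ, Set.Finite {a : A' | p ^ k • a = 0} :=
    primaryTorsion_setOf_pow_nsmul_eq_zero_finite W p
  have hdiv : ∀ a : A', ∃ b : A', p • b = a := W.smul_surjective_primaryTorsion p
  have hfix : Set.Finite {a : A' | ∀ σ ∈ I, ρ σ a = a} :=
    W.finite_setOf_primaryTorsionGaloisRep_localMap_fixed_of_hasAdditiveReductionAt p hpv hv
  haveI hI : Subsingleton (continuousCohomology 1 ((ρ.restrict (Literature.NumberTheory.GaloisRepresentations.subgroupIncl I)).toTopRep)) :=
    subsingleton_continuousCohomology_one_absInertia_of_finite_invariants Fv hℓ ρ hA hdiv hfin hfix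
  -- transfer along `I ≅ I ∩ Hi`
  have hle : I ≤ Hi := absInertia_le_localSubgroup κ hpv
  let θ : I →ₜ* I.subgroupOf Hi :=
    { toFun := fun x ↦ ⟨⟨x.1, hle x.2⟩, Subgroup.mem_subgroupOf.mpr x.2⟩
      map_one' := rfl
      map_mul' := fun _ _ ↦ rfl
      continuous_toFun := (continuous_subtype_val.subtype_mk _).subtype_mk _ }
  have hθ : Surjective θ := fun y ↦
    ⟨⟨((y : Hi) : G), Subgroup.mem_subgroupOf.mp y.2⟩, Subtype.ext (Subtype.ext rfl)⟩
  let X : TopRep ℤ (I.subgroupOf Hi) := subgroupRep (discreteTopRep Hi A') (I.subgroupOf Hi)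
  have heq : TopRep.res (θ : I →* I.subgroupOf Hi) X = (ρ.restrict (Literature.NumberTheory.GaloisRepresentations.subgroupIncl I)).toTopRep := rfl
  have hinj := map_one_injective_of_surjective X θ hθ
  haveI hI' : Subsingleton (continuousCohomology 1 (TopRep.res (θ : I →* I.subgroupOf Hi) X)) := by
    rw [heq]; exact hI
  haveI : Subsingleton (continuousCohomology 1 X) := ⟨fun a b ↦ hinj (Subsingleton.elim _ _)⟩
  -- the `g9` chain of transports
  haveI := absInertia_normal_holds Fv
  rw [← natCard_pTorsion_subgroupH1_inf_decomp_eq_kerD W κ hpv hD,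
    natCard_pTorsion_subgroupH1_inf_decomp_eq_localSubgroup W κ hpv hD,
    natCard_pTorsion_subgroupH1_localSubgroup_eq κ hpv hns hA hcont]
  rw [Nat.card_eq_one_iff_unique]
  exact ⟨inferInstance, ⟨⟨0, fun h ↦ map_zero _, smul_zero _⟩⟩⟩

/-- **The local exponent vanishes at an additive place**: if `#H¹(kerD κ v, E[p^∞])[p] = p^s` (the
exponent `s_v` of `UniversalToricDescentSigmaLocalImage.invariantsTransportT_algebraicHalf_lambda`) at a place
`v ∤ p` of additive reduction finitely decomposed in `κ`, then `s = 0`.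
[cite: GreenbergVatsal2000, §2 Prop. (2.4) (arXiv p. 22)] -/
theorem localExponent_eq_zero_of_hasAdditiveReductionAt
    (hpv : (p : 𝓞 K) ∉ v.asIdeal) (hD : ¬ (decomp v ≤ κ.kerSubgroup))
    (hv : W.HasAdditiveReductionAt v) {s : ℕ}
    (hs : Nat.card {f : Literature.NumberTheory.EllipticCurves.subgroupH1 (kerD κ v)
        (W.geomPrimaryTorsion p) // p • f = 0} = p ^ s) : s = 0 := by
  rw [natCard_pTorsion_subgroupH1_kerD_eq_one_of_hasAdditiveReductionAt W κ hpv hD hv] at hs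
  exact (Nat.pow_eq_one.mp hs.symm).resolve_left (Fact.out : p.Prime).one_lt.ne'

end Summit.BirchSwinnertonDyer.BirchSwinnertonDyer.Theorems.UniversalToricDescentAdditiveLocalTerm

end
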